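import Mathlib.Analysis.SpecialFunctions.Gamma.Beta
import Mathlib.Analysis.SpecialFunctions.Gaussian.GaussianIntegral
import Mathlib.Analysis.SpecialFunctions.Trigonometric.DerivHyp
import Mathlib.Analysis.Convex.Deriv
import Mathlib.Analysis.SpecialFunctions.Log.Deriv
import Mathlib.Analysis.Real.Pi.Bounds
import Mathlib.Analysis.Complex.ExponentialBounds
import HarnessLib

/-!
# A Stirling-order bound for `Γ(s) cos(πs/2)` on the strip `1/2 ≤ Re s ≤ 1`

Mathlib has no form of Stirling's formula for the complex Gamma function. This file proves the
elementary substitute needed for the functional equation of `ζ` in the form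
`ζ(1-s) = 2(2π)^{-s} Γ(s) cos(πs/2) ζ(s)` (`riemannZeta_one_sub`): for `1/2 ≤ x ≤ 1` and real `y`,

  `‖Γ(x+iy)‖ · ‖cos(π(x+iy)/2)‖ ≤ 4π² (1+|y|)^{x-1/2}`      (`norm_Gamma_mul_norm_cos_le`),

which is the classical `|χ(s)| ≍ |t|^{1/2-σ}` (Titchmarsh, *The Theory of the Riemann
Zeta-Function*, (4.12.3)) up to the constant. The proof avoids Stirling: Euler's limit formula
(`Complex.GammaSeq_tendsto_Gamma`) gives `Γ(x)²/|Γ(x+iy)|² = ∏_{j ≥ 0} (1 + y²/(x+j)²)`, whose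
logarithm is a convex function of `x > 0` (each factor `log(1 + y²/(x+j)²)` is convex); the exact
values at `x = 1` (`|Γ(1+iy)|² = πy/sinh πy`) and `x = 3/2` (`|Γ(3/2+iy)|² = (1/4+y²)π/cosh πy`),
both from the reflection formula, then bound `|Γ(x+iy)|²` from above on `1/2 ≤ x ≤ 1` by the
secant through `x = 1, 3/2`, and `|cos(π(x+iy)/2)|² ≤ cosh²(πy/2) ≤ cosh πy` cancels the exponential
decay. All statements are textbook material and tagged folklore; the file has no definitions.

## References

* E. C. Titchmarsh, *The Theory of the Riemann Zeta-Function*, 2nd ed. (1986), §4.12, (4.12.3).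
* E. T. Whittaker, G. N. Watson, *A Course of Modern Analysis*, 4th ed., §12.13, §12.14, §13.6.
-/

noncomputable section

open Real Set Filter Topology Complex

namespace Literature.Analysis.SpecialFunctions.GammaVert

/-! ### Convexity of `x ↦ log(1 + c/(x+a)²)` -/

/-- For `c ≥ 0`, `a ≥ 0` the function `u ↦ log((u+a)² + c) - 2 log(u+a)` (`= log(1 + c/(u+a)²)`) is
convex on `(0, ∞)`: its second derivative is `(6(u+a)²c + 2c²)/((u+a)²((u+a)²+c)²) ≥ 0`.
[folklore] -/
lemma convexOn_log_sq_add_sub (c a : ℝ) (hc : 0 ≤ c) (ha : 0 ≤ a) :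
    ConvexOn ℝ (Ioi 0) (fun u : ℝ ↦ Real.log ((u + a) ^ 2 + c) - 2 * Real.log (u + a)) := by
  have hpos : ∀ u ∈ interior (Ioi (0 : ℝ)), 0 < u + a := by
    intro u hu
    rw [interior_Ioi] at hu
    have : (0 : ℝ) < u := hu
    linarith
  have hsq : ∀ u : ℝ, HasDerivAt (fun u : ℝ ↦ (u + a) ^ 2 + c) (2 * (u + a)) u := by
    intro u
    have := (((hasDerivAt_id u).add_const a).pow 2).add_const c
    simpa using this
  -- first derivative
  have hd1 : ∀ u : ℝ, 0 < u + a → HasDerivAt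
      (fun u : ℝ ↦ Real.log ((u + a) ^ 2 + c) - 2 * Real.log (u + a))
      (2 * (u + a) / ((u + a) ^ 2 + c) - 2 * (u + a)⁻¹) u := by
    intro u hu
    have hp : 0 < (u + a) ^ 2 + c := by positivity
    have h2 : HasDerivAt (fun u : ℝ ↦ Real.log ((u + a) ^ 2 + c))
        (2 * (u + a) / ((u + a) ^ 2 + c)) u := (hsq u).log hp.ne'
    have h3 : HasDerivAt (fun u : ℝ ↦ Real.log (u + a)) (1 / (u + a)) u :=
      ((hasDerivAt_id u).add_const a).log hu.ne'
    have h4 := h2.sub (h3.const_mul 2)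
    simp only [one_div] at h4
    exact h4
  -- second derivative
  have hd2 : ∀ u : ℝ, 0 < u + a → HasDerivAt
      (fun u : ℝ ↦ 2 * (u + a) / ((u + a) ^ 2 + c) - 2 * (u + a)⁻¹)
      ((2 * ((u + a) ^ 2 + c) - 2 * (u + a) * (2 * (u + a))) / ((u + a) ^ 2 + c) ^ 2 -
        2 * (-1 / (u + a) ^ 2)) u := by
    intro u hu
    have hp : 0 < (u + a) ^ 2 + c := by positivity
    have hn : HasDerivAt (fun u : ℝ ↦ 2 * (u + a)) 2 u := by
      simpa using ((hasDerivAt_id u).add_const a).const_mul 2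
    have h2 := hn.fun_div (hsq u) hp.ne'
    have h3 := (((hasDerivAt_id u).add_const a).fun_inv hu.ne').const_mul 2
    simp only [id] at h3
    exact h2.fun_sub h3
  have hnn : ∀ u : ℝ, 0 < u + a → 0 ≤
      (2 * ((u + a) ^ 2 + c) - 2 * (u + a) * (2 * (u + a))) / ((u + a) ^ 2 + c) ^ 2 -
        2 * (-1 / (u + a) ^ 2) := by
    intro u hu
    have hp : 0 < (u + a) ^ 2 + c := by positivity
    have key : (2 * ((u + a) ^ 2 + c) - 2 * (u + a) * (2 * (u + a))) / ((u + a) ^ 2 + c) ^ 2 -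
        2 * (-1 / (u + a) ^ 2) =
        (6 * (u + a) ^ 2 * c + 2 * c ^ 2) / ((u + a) ^ 2 * ((u + a) ^ 2 + c) ^ 2) := by
      field_simp
      ring
    rw [key]
    positivity
  refine convexOn_of_hasDerivWithinAt2_nonneg (convex_Ioi 0) ?_ ?_ ?_ ?_
    (f' := fun u ↦ 2 * (u + a) / ((u + a) ^ 2 + c) - 2 * (u + a)⁻¹)
    (f'' := fun u ↦ (2 * ((u + a) ^ 2 + c) - 2 * (u + a) * (2 * (u + a))) /
      ((u + a) ^ 2 + c) ^ 2 - 2 * (-1 / (u + a) ^ 2))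
  · intro u hu
    have hu' : 0 < u + a := by have : (0 : ℝ) < u := hu; linarith
    exact (hd1 u hu').continuousAt.continuousWithinAt
  · exact fun u hu ↦ (hd1 u (hpos u hu)).hasDerivWithinAt
  · exact fun u hu ↦ (hd2 u (hpos u hu)).hasDerivWithinAt
  · exact fun u hu ↦ hnn u (hpos u hu)

/-- `log((u+a)² + c) - 2 log(u+a) = log(1 + c/(u+a)²)` for `u + a > 0`, `c ≥ 0`. [folklore] -/
lemma log_sq_add_sub_eq (c a u : ℝ) (hc : 0 ≤ c) (hu : 0 < u + a) :
    Real.log ((u + a) ^ 2 + c) - 2 * Real.log (u + a) = Real.log (1 + c / (u + a) ^ 2) := by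
  have hp : 0 < (u + a) ^ 2 + c := by positivity
  rw [show (1 + c / (u + a) ^ 2) = ((u + a) ^ 2 + c) / (u + a) ^ 2 by field_simp,
    Real.log_div hp.ne' (by positivity), Real.log_pow]
  push_cast
  ring

/-! ### The Euler product for `Γ(x)²/|Γ(x+iy)|²` -/

/-- `1 ≤ ∏_{j ≤ n} (1 + y²/(x+j)²)`. [folklore] -/
lemma one_le_prod_one_add_div_sq (y : ℝ) (n : ℕ) (x : ℝ) :
    1 ≤ ∏ j ∈ Finset.range (n + 1), (1 + y ^ 2 / (x + j) ^ 2) := by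
  refine Finset.one_le_prod fun j _ ↦ ?_
  have : 0 ≤ y ^ 2 / (x + j) ^ 2 := by positivity
  linarith

/-- Convexity in `x > 0` of `log ∏_{j ≤ n} (1 + y²/(x+j)²)`. [folklore] -/
lemma convexOn_log_prod_one_add_div_sq (y : ℝ) (n : ℕ) :
    ConvexOn ℝ (Ioi 0)
      (fun x : ℝ ↦ Real.log (∏ j ∈ Finset.range (n + 1), (1 + y ^ 2 / (x + j) ^ 2))) := by
  have h : ConvexOn ℝ (Ioi 0) (fun x : ℝ ↦ ∑ j ∈ Finset.range (n + 1),
      (Real.log ((x + j) ^ 2 + y ^ 2) - 2 * Real.log (x + j))) := by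
    induction (Finset.range (n + 1)) using Finset.induction_on with
    | empty => simpa using convexOn_const (0 : ℝ) (convex_Ioi 0)
    | insert j s hj ih =>
      simp_rw [Finset.sum_insert hj]
      exact (convexOn_log_sq_add_sub (y ^ 2) j (sq_nonneg y) (Nat.cast_nonneg j)).add ih
  refine h.congr fun x hx ↦ ?_
  have hx' : (0 : ℝ) < x := hx
  dsimp only
  rw [Real.log_prod]
  · refine Finset.sum_congr rfl fun j _ ↦ ?_
    rw [log_sq_add_sub_eq (y ^ 2) j x (sq_nonneg y) (by positivity)]
  · intro j _
    positivity

/-- Level-`n` form of Euler's product: `‖GammaSeq (x+iy) n‖² · ∏_{j ≤ n} (1 + y²/(x+j)²) =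
GammaSeq x n ²` for `x > 0`. [folklore] -/
lemma norm_GammaSeq_sq_mul_prod {x : ℝ} (hx : 0 < x) (y : ℝ) (n : ℕ) :
    ‖Complex.GammaSeq (x + y * I) n‖ ^ 2 * ∏ j ∈ Finset.range (n + 1), (1 + y ^ 2 / (x + j) ^ 2) =
      (Real.GammaSeq x n) ^ 2 := by
  unfold Complex.GammaSeq Real.GammaSeq
  have hre : (x + y * I : ℂ).re = x := by simp
  have hn : ‖((n : ℂ)) ^ (x + y * I : ℂ)‖ = (n : ℝ) ^ x := by
    rw [← Complex.ofReal_natCast, Complex.norm_cpow_eq_rpow_re_of_nonneg (Nat.cast_nonneg n)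
      (by rw [hre]; exact hx.ne'), hre]
  rw [norm_div, norm_mul, hn, Complex.norm_natCast, norm_prod, div_pow, mul_pow, div_pow,
    ← Finset.prod_pow]
  have hfac : ∀ j ∈ Finset.range (n + 1),
      ‖(x + y * I : ℂ) + (j : ℕ)‖ ^ 2 = (x + j) ^ 2 * (1 + y ^ 2 / (x + j) ^ 2) := by
    intro j _
    have hxj : 0 < x + j := by positivity
    rw [Complex.sq_norm, Complex.normSq_apply]
    simp
    field_simp
  rw [Finset.prod_congr rfl hfac, Finset.prod_mul_distrib]
  have hP : 0 < ∏ j ∈ Finset.range (n + 1), (1 + y ^ 2 / (x + j) ^ 2) :=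
    lt_of_lt_of_le one_pos (one_le_prod_one_add_div_sq y n x)
  have hX : 0 < ∏ j ∈ Finset.range (n + 1), (x + (j : ℕ)) ^ 2 :=
    Finset.prod_pos fun j _ ↦ by positivity
  field_simp
  rw [Finset.prod_pow]

/-- `Γ(x+iy) ≠ 0` for `x > 0`. [folklore] -/
lemma Gamma_ne_zero_of_pos {x : ℝ} (hx : 0 < x) (y : ℝ) : Complex.Gamma (x + y * I) ≠ 0 :=
  Complex.Gamma_ne_zero_of_re_pos (by simpa using hx)

/-- `GammaSeq (x+iy) n ≠ 0` for `x > 0`, `n ≠ 0`. [folklore] -/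
lemma GammaSeq_ne_zero {x : ℝ} (hx : 0 < x) (y : ℝ) {n : ℕ} (hn : n ≠ 0) :
    Complex.GammaSeq (x + y * I) n ≠ 0 := by
  unfold Complex.GammaSeq
  refine div_ne_zero (mul_ne_zero ?_ ?_) ?_
  · exact cpow_ne_zero_iff.mpr (Or.inl (Nat.cast_ne_zero.mpr hn))
  · exact_mod_cast Nat.factorial_ne_zero n
  · refine Finset.prod_ne_zero_iff.mpr fun j _ h ↦ ?_
    have := congrArg Complex.re h
    simp at this
    have : (0 : ℝ) ≤ j := Nat.cast_nonneg j
    linarith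

/-- **Euler's product for `Γ(x)²/|Γ(x+iy)|²`** (Whittaker–Watson §13.6, from Euler's limit formula
`Complex.GammaSeq_tendsto_Gamma`): `∏_{j ≤ n} (1 + y²/(x+j)²) → Γ(x)²/‖Γ(x+iy)‖²` for `x > 0`.
[folklore] -/
theorem tendsto_prod_one_add_div_sq {x : ℝ} (hx : 0 < x) (y : ℝ) :
    Tendsto (fun n ↦ ∏ j ∈ Finset.range (n + 1), (1 + y ^ 2 / (x + j) ^ 2)) atTop
      (𝓝 (Real.Gamma x ^ 2 / ‖Complex.Gamma (x + y * I)‖ ^ 2)) := by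
  have h1 := (Real.GammaSeq_tendsto_Gamma x).pow 2
  have h2 := ((Complex.GammaSeq_tendsto_Gamma (x + y * I)).norm).pow 2
  have hne : ‖Complex.Gamma (x + y * I)‖ ^ 2 ≠ 0 :=
    pow_ne_zero 2 (norm_ne_zero_iff.mpr (Gamma_ne_zero_of_pos hx y))
  refine ((h1.div h2 hne).congr' ?_)
  filter_upwards [eventually_ne_atTop 0] with n hn
  have hid := norm_GammaSeq_sq_mul_prod hx y n
  have hz : ‖Complex.GammaSeq (x + y * I) n‖ ^ 2 ≠ 0 :=
    pow_ne_zero 2 (norm_ne_zero_iff.mpr (GammaSeq_ne_zero hx y hn))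
  simp only [Pi.div_apply]
  rw [div_eq_iff hz, ← hid, mul_comm]

/-- `Γ(x)²/‖Γ(x+iy)‖² > 0` for `x > 0`. [folklore] -/
lemma gammaRatio_pos {x : ℝ} (hx : 0 < x) (y : ℝ) :
    0 < Real.Gamma x ^ 2 / ‖Complex.Gamma (x + y * I)‖ ^ 2 := by
  have h1 : 0 < Real.Gamma x := Real.Gamma_pos_of_pos hx
  have h2 : 0 < ‖Complex.Gamma (x + y * I)‖ := norm_pos_iff.mpr (Gamma_ne_zero_of_pos hx y)
  positivity

/-- `1 ≤ Γ(x)²/‖Γ(x+iy)‖²` for `x > 0`. [folklore] -/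
lemma one_le_gammaRatio {x : ℝ} (hx : 0 < x) (y : ℝ) :
    1 ≤ Real.Gamma x ^ 2 / ‖Complex.Gamma (x + y * I)‖ ^ 2 :=
  ge_of_tendsto' (tendsto_prod_one_add_div_sq hx y) fun n ↦ one_le_prod_one_add_div_sq y n x

/-- `|Γ(x+iy)| ≤ Γ(x)` for `x > 0` (Whittaker–Watson §12.13 ex.). [folklore] -/
theorem norm_Gamma_le_Gamma_re {x : ℝ} (hx : 0 < x) (y : ℝ) :
    ‖Complex.Gamma (x + y * I)‖ ≤ Real.Gamma x := by
  have h := one_le_gammaRatio hx y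
  have h2 : 0 < ‖Complex.Gamma (x + y * I)‖ := norm_pos_iff.mpr (Gamma_ne_zero_of_pos hx y)
  rw [le_div_iff₀ (by positivity), one_mul] at h
  exact le_of_sq_le_sq h (Real.Gamma_pos_of_pos hx).le

/-- The logarithm of the level-`n` product tends to `log(Γ(x)²/‖Γ(x+iy)‖²)`. [folklore] -/
lemma tendsto_log_prod_one_add_div_sq {x : ℝ} (hx : 0 < x) (y : ℝ) :
    Tendsto (fun n ↦ Real.log (∏ j ∈ Finset.range (n + 1), (1 + y ^ 2 / (x + j) ^ 2))) atTop
      (𝓝 (Real.log (Real.Gamma x ^ 2 / ‖Complex.Gamma (x + y * I)‖ ^ 2))) :=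
  (Real.continuousAt_log (gammaRatio_pos hx y).ne').tendsto.comp (tendsto_prod_one_add_div_sq hx y)

/-- **Log-convexity of `x ↦ Γ(x)²/‖Γ(x+iy)‖²`** on `x > 0`, in three-point (slope) form.
[folklore] -/
theorem slope_log_gammaRatio_mono (y : ℝ) {a b c : ℝ} (ha : 0 < a) (hab : a < b) (hbc : b < c) :
    (Real.log (Real.Gamma b ^ 2 / ‖Complex.Gamma (b + y * I)‖ ^ 2) -
        Real.log (Real.Gamma a ^ 2 / ‖Complex.Gamma (a + y * I)‖ ^ 2)) / (b - a) ≤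
      (Real.log (Real.Gamma c ^ 2 / ‖Complex.Gamma (c + y * I)‖ ^ 2) -
        Real.log (Real.Gamma b ^ 2 / ‖Complex.Gamma (b + y * I)‖ ^ 2)) / (c - b) := by
  have hb : 0 < b := ha.trans hab
  have hc : 0 < c := hb.trans hbc
  refine le_of_tendsto_of_tendsto' (((tendsto_log_prod_one_add_div_sq hb y).sub
    (tendsto_log_prod_one_add_div_sq ha y)).div_const (b - a))
    (((tendsto_log_prod_one_add_div_sq hc y).sub
      (tendsto_log_prod_one_add_div_sq hb y)).div_const (c - b)) fun n ↦ ?_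
  exact (convexOn_log_prod_one_add_div_sq y n).slope_mono_adjacent ha hc hab hbc

/-! ### Exact values from the reflection formula -/

/-- `‖z‖² = Re(z z̄)`. [folklore] -/
lemma normSq_eq_mul_conj_re (z : ℂ) : ‖z‖ ^ 2 = (z * (starRingEnd ℂ) z).re := by
  rw [Complex.mul_conj, Complex.sq_norm]; simp

/-- `|Γ(1/2 + iy)|² = π / cosh(π y)` (reflection formula at `s = 1/2 + iy`). [folklore] -/
theorem norm_sq_Gamma_half (y : ℝ) :
    ‖Complex.Gamma (1 / 2 + y * I)‖ ^ 2 = π / Real.cosh (π * y) := by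
  set z : ℂ := 1 / 2 + y * I with hz
  have hconj : (starRingEnd ℂ) z = 1 - z := by
    rw [hz]; simp [Complex.ext_iff]; norm_num
  have h := Complex.Gamma_mul_Gamma_one_sub z
  rw [← hconj, Complex.Gamma_conj] at h
  have hsin : Complex.sin (π * z) = Real.cosh (π * y) := by
    rw [hz, mul_add, show (π : ℂ) * (1 / 2) = π / 2 by ring, Complex.sin_add]
    simp [Complex.cos_pi_div_two, Complex.sin_pi_div_two]
    rw [show (π : ℂ) * (y * I) = (π * y : ℝ) * I by push_cast; ring, Complex.cos_mul_I]
    push_cast; ring_nf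
  rw [hsin] at h
  rw [normSq_eq_mul_conj_re, h]
  rw [show (π : ℂ) / (Real.cosh (π * y) : ℂ) = ((π / Real.cosh (π * y) : ℝ) : ℂ) by push_cast; rfl,
    Complex.ofReal_re]

/-- `|Γ(1 + iy)|² = π y / sinh(π y)` for `y ≠ 0` (reflection formula and `Γ(1+w) = wΓ(w)`).
[folklore] -/
theorem norm_sq_Gamma_one (y : ℝ) (hy : y ≠ 0) :
    ‖Complex.Gamma (1 + y * I)‖ ^ 2 = π * y / Real.sinh (π * y) := by
  set w : ℂ := y * I with hw
  have hw0 : w ≠ 0 := by rw [hw]; simp [hy]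
  have hconj : (starRingEnd ℂ) (1 + w) = 1 - w := by
    rw [hw]; simp [Complex.ext_iff]
  have h := Complex.Gamma_mul_Gamma_one_sub w
  have h1 : Complex.Gamma (1 + w) = w * Complex.Gamma w := by
    rw [add_comm]; exact Complex.Gamma_add_one w hw0
  have hsin : Complex.sin (π * w) = Real.sinh (π * y) * I := by
    rw [hw, show (π : ℂ) * (y * I) = (π * y : ℝ) * I by push_cast; ring, Complex.sin_mul_I,
      ← Complex.ofReal_sinh]
  have hsinh : Real.sinh (π * y) ≠ 0 := by
    exact Real.sinh_ne_zero.mpr (mul_ne_zero Real.pi_pos.ne' hy)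
  have key : Complex.Gamma (1 + w) * (starRingEnd ℂ) (Complex.Gamma (1 + w)) =
      ((π * y / Real.sinh (π * y) : ℝ) : ℂ) := by
    rw [← Complex.Gamma_conj, hconj, h1, mul_assoc, h, hsin, hw]
    push_cast
    field_simp
  rw [normSq_eq_mul_conj_re, key, Complex.ofReal_re]

/-- `|Γ(3/2 + iy)|² = (1/4 + y²) π / cosh(π y)`. [folklore] -/
theorem norm_sq_Gamma_three_halves (y : ℝ) :
    ‖Complex.Gamma (3 / 2 + y * I)‖ ^ 2 = (1 / 4 + y ^ 2) * (π / Real.cosh (π * y)) := by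
  have hz : (1 / 2 + y * I : ℂ) ≠ 0 := by
    intro h; have := congrArg Complex.re h; norm_num at this
  have h1 : Complex.Gamma (3 / 2 + y * I) = (1 / 2 + y * I) * Complex.Gamma (1 / 2 + y * I) := by
    rw [show (3 / 2 + y * I : ℂ) = (1 / 2 + y * I) + 1 by ring]
    exact Complex.Gamma_add_one _ hz
  rw [h1, norm_mul, mul_pow, norm_sq_Gamma_half]
  congr 1
  rw [Complex.sq_norm, Complex.normSq_apply]; simp; ring

/-- `Γ(1/2)² = π`. [folklore] -/
lemma Real_Gamma_half_sq : Real.Gamma (1 / 2) ^ 2 = π := by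
  rw [Real.Gamma_one_half_eq, Real.sq_sqrt Real.pi_pos.le]

/-- `Γ(3/2)² = π/4`. [folklore] -/
lemma Real_Gamma_three_halves_sq : Real.Gamma (3 / 2) ^ 2 = π / 4 := by
  rw [show (3 / 2 : ℝ) = 1 / 2 + 1 by norm_num, Real.Gamma_add_one (by norm_num), mul_pow,
    Real_Gamma_half_sq]
  ring

/-- `‖cos z‖ ≤ cosh (Im z)`. [folklore] -/
lemma norm_cos_le_cosh_im (z : ℂ) : ‖Complex.cos z‖ ≤ Real.cosh z.im := by
  have hrepr : Complex.cos z = ((Real.cos z.re * Real.cosh z.im : ℝ) : ℂ) +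
      ((-(Real.sin z.re * Real.sinh z.im) : ℝ) : ℂ) * I := by
    rw [Complex.cos_eq]; push_cast; ring
  have h : ‖Complex.cos z‖ ^ 2 ≤ Real.cosh z.im ^ 2 := by
    rw [hrepr, Complex.sq_norm, Complex.normSq_add_mul_I]
    have hc : Real.cos z.re ^ 2 + Real.sin z.re ^ 2 = 1 := Real.cos_sq_add_sin_sq z.re
    have hsh : Real.sinh z.im ^ 2 ≤ Real.cosh z.im ^ 2 := by
      rw [Real.cosh_sq]; linarith [sq_nonneg (Real.sinh z.im)]
    nlinarith [sq_nonneg (Real.cos z.re), sq_nonneg (Real.sin z.re), sq_nonneg (Real.cosh z.im),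
      mul_nonneg (sq_nonneg (Real.sin z.re)) (sub_nonneg.mpr hsh)]
  exact le_of_sq_le_sq h (Real.cosh_pos _).le

/-- `Γ(1)²/‖Γ(1+iy)‖² = sinh(πy)/(πy)` for `y ≠ 0`. [folklore] -/
lemma gammaRatio_one {y : ℝ} (hy : y ≠ 0) :
    Real.Gamma 1 ^ 2 / ‖Complex.Gamma ((1 : ℝ) + y * I)‖ ^ 2 = Real.sinh (π * y) / (π * y) := by
  rw [Real.Gamma_one, Complex.ofReal_one, norm_sq_Gamma_one y hy]
  have hs : Real.sinh (π * y) ≠ 0 := Real.sinh_ne_zero.mpr (mul_ne_zero Real.pi_pos.ne' hy)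
  have : π * y ≠ 0 := mul_ne_zero Real.pi_pos.ne' hy
  field_simp

/-- `Γ(3/2)²/‖Γ(3/2+iy)‖² = cosh(πy)/(1+4y²)`. [folklore] -/
lemma gammaRatio_three_halves (y : ℝ) :
    Real.Gamma (3 / 2) ^ 2 / ‖Complex.Gamma ((3 / 2 : ℝ) + y * I)‖ ^ 2 =
      Real.cosh (π * y) / (1 + 4 * y ^ 2) := by
  have hc : 0 < Real.cosh (π * y) := Real.cosh_pos _
  rw [Real_Gamma_three_halves_sq, show ((3 / 2 : ℝ) : ℂ) = 3 / 2 by push_cast; ring,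
    norm_sq_Gamma_three_halves]
  field_simp

/-- Secant bound from log-convexity through the nodes `1 < 3/2`, evaluated at `0 < x ≤ 1`:
`(3-2x) log Q(1) - (2-2x) log Q(3/2) ≤ log Q(x)` for `Q(x) = Γ(x)²/‖Γ(x+iy)‖²`. [folklore] -/
lemma log_gammaRatio_ge (y : ℝ) {x : ℝ} (hx0 : 0 < x) (hx1 : x ≤ 1) :
    (3 - 2 * x) * Real.log (Real.Gamma 1 ^ 2 / ‖Complex.Gamma ((1 : ℝ) + y * I)‖ ^ 2) -
        (2 - 2 * x) * Real.log (Real.Gamma (3 / 2) ^ 2 / ‖Complex.Gamma ((3 / 2 : ℝ) + y * I)‖ ^ 2) ≤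
      Real.log (Real.Gamma x ^ 2 / ‖Complex.Gamma (x + y * I)‖ ^ 2) := by
  rcases eq_or_lt_of_le hx1 with rfl | hlt
  · norm_num
  have h := slope_log_gammaRatio_mono y hx0 hlt (by norm_num : (1 : ℝ) < 3 / 2)
  rw [div_le_div_iff₀ (by linarith) (by norm_num)] at h
  nlinarith

/-- The main estimate for `y ≥ 1`, `1/2 ≤ x ≤ 1`:
`‖Γ(x+iy)‖² ‖cos(π(x+iy)/2)‖² ≤ 4π³ · exp((2x-1) log y) = 4π³ y^{2x-1}`. [folklore] -/
theorem norm_sq_Gamma_mul_cos_le_of_one_le {x y : ℝ} (hx : 1 / 2 ≤ x) (hx1 : x ≤ 1) (hy : 1 ≤ y) :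
    ‖Complex.Gamma (x + y * I)‖ ^ 2 * ‖Complex.cos (π * (x + y * I) / 2)‖ ^ 2 ≤
      4 * π ^ 3 * Real.exp ((2 * x - 1) * Real.log y) := by
  have hx0 : 0 < x := by linarith
  have hy0 : 0 < y := by linarith
  have hyne : y ≠ 0 := hy0.ne'
  set c := Real.cosh (π * y) with hc
  set s := Real.sinh (π * y) with hs
  have hπy : 0 < π * y := by positivity
  have hcpos : 0 < c := Real.cosh_pos _
  have hspos : 0 < s := Real.sinh_pos_iff.mpr hπy
  -- (1) the Gamma factor through the log-convexity inequality
  have hQ := log_gammaRatio_ge y hx0 hx1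
  rw [gammaRatio_one hyne, gammaRatio_three_halves] at hQ
  have hQx : 0 < Real.Gamma x ^ 2 / ‖Complex.Gamma (x + y * I)‖ ^ 2 := gammaRatio_pos hx0 y
  have hG : ‖Complex.Gamma (x + y * I)‖ ^ 2 =
      Real.Gamma x ^ 2 / (Real.Gamma x ^ 2 / ‖Complex.Gamma (x + y * I)‖ ^ 2) := by
    have : 0 < ‖Complex.Gamma (x + y * I)‖ := norm_pos_iff.mpr (Gamma_ne_zero_of_pos hx0 y)
    have : 0 < Real.Gamma x := Real.Gamma_pos_of_pos hx0
    field_simp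
  -- (2) the cosine factor
  have hcos : ‖Complex.cos (π * (x + y * I) / 2)‖ ^ 2 ≤ c := by
    have h1 := norm_cos_le_cosh_im (π * (x + y * I) / 2)
    have him : (π * (x + y * I) / 2 : ℂ).im = π * y / 2 := by simp
    rw [him] at h1
    have h2 : Real.cosh (π * y / 2) ^ 2 ≤ c := by
      have h3 : Real.cosh (π * y) = Real.cosh (π * y / 2) ^ 2 + Real.sinh (π * y / 2) ^ 2 := by
        rw [← Real.cosh_two_mul]; ring_nf
      have h4 := Real.cosh_sq (π * y / 2)
      rw [hc, h3]; nlinarith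
    calc ‖Complex.cos (π * (x + y * I) / 2)‖ ^ 2 ≤ Real.cosh (π * y / 2) ^ 2 := by
          gcongr
      _ ≤ c := h2
  -- (3) elementary bounds: c ≤ 2 s, log(1+4y²) ≥ log 4 + 2 log y, Γ(x)² ≤ π
  have hcs : c ≤ 2 * s := by
    rw [hc, hs, Real.cosh_eq, Real.sinh_eq]
    have : Real.exp (-(π * y)) * 3 ≤ Real.exp (π * y) := by
      have h1 : π * y + 1 ≤ Real.exp (π * y) := Real.add_one_le_exp _
      have h2 : Real.exp (-(π * y)) ≤ 1 := by
        rw [Real.exp_le_one_iff]; linarith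
      have h3 : 3 ≤ π * y + 1 := by nlinarith [Real.pi_gt_three]
      nlinarith [Real.exp_pos (-(π * y))]
    linarith
  have hlogcs : Real.log c - Real.log s ≤ Real.log 2 := by
    rw [← Real.log_div hcpos.ne' hspos.ne']
    exact Real.log_le_log (by positivity) (by rw [div_le_iff₀ hspos]; linarith)
  have hlog4 : Real.log 4 + 2 * Real.log y ≤ Real.log (1 + 4 * y ^ 2) := by
    have : Real.log 4 + 2 * Real.log y = Real.log (4 * y ^ 2) := by
      rw [Real.log_mul (by norm_num) (by positivity), Real.log_pow]; push_cast; ring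
    rw [this]
    exact Real.log_le_log (by positivity) (by linarith)
  have hGammax : Real.Gamma x ^ 2 ≤ π := by
    have h1 : Real.Gamma x ≤ max (Real.Gamma (1 / 2)) (Real.Gamma 1) :=
      Real.convexOn_Gamma.le_max_of_mem_Icc (by norm_num) (by norm_num) ⟨hx, hx1⟩
    rw [Real.Gamma_one, Real.Gamma_one_half_eq, max_eq_left (by
      rw [Real.le_sqrt (by norm_num) Real.pi_pos.le]; linarith [Real.pi_gt_three])] at h1
    have h0 : 0 ≤ Real.Gamma x := (Real.Gamma_pos_of_pos hx0).le
    calc Real.Gamma x ^ 2 ≤ Real.sqrt π ^ 2 := pow_le_pow_left₀ h0 h1 2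
      _ = π := Real.sq_sqrt Real.pi_pos.le
  -- (4) assemble in log form
  have hlogπy : Real.log (π * y) = Real.log π + Real.log y :=
    Real.log_mul Real.pi_pos.ne' hyne
  have hlogs1 : Real.log (s / (π * y)) = Real.log s - Real.log (π * y) :=
    Real.log_div hspos.ne' hπy.ne'
  have hlogc32 : Real.log (c / (1 + 4 * y ^ 2)) = Real.log c - Real.log (1 + 4 * y ^ 2) :=
    Real.log_div hcpos.ne' (by positivity)
  rw [hlogs1, hlogc32] at hQ
  have hinvQ : (Real.Gamma x ^ 2 / ‖Complex.Gamma (x + y * I)‖ ^ 2)⁻¹ ≤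
      Real.exp (-((3 - 2 * x) * (Real.log s - Real.log (π * y))) +
        (2 - 2 * x) * (Real.log c - Real.log (1 + 4 * y ^ 2))) := by
    rw [← Real.exp_log hQx, ← Real.exp_neg]
    exact Real.exp_le_exp.mpr (by linarith)
  have hE : -((3 - 2 * x) * (Real.log s - Real.log (π * y))) +
        (2 - 2 * x) * (Real.log c - Real.log (1 + 4 * y ^ 2)) + Real.log c ≤
      Real.log (4 * π ^ 2) + (2 * x - 1) * Real.log y := by
    have h32 : 0 ≤ 3 - 2 * x := by linarith
    have h22 : 0 ≤ 2 - 2 * x := by linarith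
    have hlog2 : 0 < Real.log 2 := Real.log_pos (by norm_num)
    have hlogπ : 0 < Real.log π := Real.log_pos (by linarith [Real.pi_gt_three])
    have hlog4' : Real.log (4 * π ^ 2) = 2 * Real.log 2 + 2 * Real.log π := by
      rw [Real.log_mul (by norm_num) (by positivity), Real.log_pow, show (4 : ℝ) = 2 ^ 2 by norm_num,
        Real.log_pow]; push_cast; ring
    have hlog4'' : Real.log 4 = 2 * Real.log 2 := by
      rw [show (4 : ℝ) = 2 ^ 2 by norm_num, Real.log_pow]; push_cast; ring
    rw [hlog4', hlogπy]
    rw [hlog4''] at hlog4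
    nlinarith [mul_le_mul_of_nonneg_left hlogcs h32, mul_le_mul_of_nonneg_left hlog4 h22,
      mul_nonneg h22 hlog2.le]
  -- final
  calc ‖Complex.Gamma (x + y * I)‖ ^ 2 * ‖Complex.cos (π * (x + y * I) / 2)‖ ^ 2
      ≤ (Real.Gamma x ^ 2 / (Real.Gamma x ^ 2 / ‖Complex.Gamma (x + y * I)‖ ^ 2)) * c := by
        rw [← hG]; gcongr
    _ = Real.Gamma x ^ 2 * ((Real.Gamma x ^ 2 / ‖Complex.Gamma (x + y * I)‖ ^ 2)⁻¹ * c) := by ring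
    _ ≤ π * (Real.exp (-((3 - 2 * x) * (Real.log s - Real.log (π * y))) +
        (2 - 2 * x) * (Real.log c - Real.log (1 + 4 * y ^ 2))) * c) := by
        gcongr
    _ = π * Real.exp (-((3 - 2 * x) * (Real.log s - Real.log (π * y))) +
        (2 - 2 * x) * (Real.log c - Real.log (1 + 4 * y ^ 2)) + Real.log c) := by
        rw [Real.exp_add _ (Real.log c), Real.exp_log hcpos]
    _ ≤ π * Real.exp (Real.log (4 * π ^ 2) + (2 * x - 1) * Real.log y) := by
        gcongr
    _ = 4 * π ^ 3 * Real.exp ((2 * x - 1) * Real.log y) := by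
        rw [Real.exp_add, Real.exp_log (by positivity)]; ring

/-- **Stirling-order bound for `Γ(s) cos(πs/2)` on `1/2 ≤ Re s ≤ 1`** (the growth
`|χ(s)| ≪ |t|^{1/2-σ}` of the factor in the functional equation of `ζ`, Titchmarsh (4.12.3), with an
explicit constant): for `1/2 ≤ x ≤ 1` and real `y`,
`‖Γ(x+iy)‖ · ‖cos(π(x+iy)/2)‖ ≤ 4π² (1+|y|)^{x-1/2}`. [folklore] -/
theorem norm_Gamma_mul_norm_cos_le {x : ℝ} (hx : 1 / 2 ≤ x) (hx1 : x ≤ 1) (y : ℝ) :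
    ‖Complex.Gamma (x + y * I)‖ * ‖Complex.cos (π * (x + y * I) / 2)‖ ≤
      4 * π ^ 2 * (1 + |y|) ^ (x - 1 / 2) := by
  have hx0 : 0 < x := by linarith
  have hπ := Real.pi_gt_three
  -- symmetry y ↦ -y
  have hsymm : ∀ y : ℝ, ‖Complex.Gamma (x + y * I)‖ * ‖Complex.cos (π * (x + y * I) / 2)‖ =
      ‖Complex.Gamma (x + |y| * I)‖ * ‖Complex.cos (π * (x + |y| * I) / 2)‖ := by
    intro y
    rcases le_or_gt 0 y with hy | hy
    · rw [abs_of_nonneg hy]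
    · rw [abs_of_neg hy]
      have h1 : (x + ((-y : ℝ) : ℂ) * I : ℂ) = (starRingEnd ℂ) (x + y * I) := by
        apply Complex.ext <;> simp
      have h2 : (π * (x + ((-y : ℝ) : ℂ) * I) / 2 : ℂ) = (starRingEnd ℂ) (π * (x + y * I) / 2) := by
        simp [map_ofNat]
      rw [h2, h1, Complex.Gamma_conj, Complex.norm_conj, Complex.cos_conj, Complex.norm_conj]
  rw [hsymm]
  set y' := |y| with hy'
  have hy'0 : 0 ≤ y' := abs_nonneg y
  have h1y : 0 < 1 + y' := by linarith
  have hrpow_ge_one : 1 ≤ (1 + y') ^ (x - 1 / 2) :=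
    Real.one_le_rpow (by linarith) (by linarith)
  have hπ2 : 0 < 4 * π ^ 2 := by positivity
  rcases le_or_gt 1 y' with h1 | h1
  · -- |y| ≥ 1: the main estimate
    have hmain := norm_sq_Gamma_mul_cos_le_of_one_le hx hx1 h1
    have hy'pos : 0 < y' := by linarith
    have hE : ((1 + y') ^ (x - 1 / 2)) ^ 2 = Real.exp ((2 * x - 1) * Real.log (1 + y')) := by
      rw [Real.rpow_def_of_pos h1y, sq, ← Real.exp_add]; ring_nf
    have hexp : Real.exp ((2 * x - 1) * Real.log y') ≤ Real.exp ((2 * x - 1) * Real.log (1 + y')) := by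
      have hlog : Real.log y' ≤ Real.log (1 + y') := Real.log_le_log hy'pos (by linarith)
      have h2x : 0 ≤ 2 * x - 1 := by linarith
      exact Real.exp_le_exp.mpr (mul_le_mul_of_nonneg_left hlog h2x)
    have hsq : (‖Complex.Gamma (x + y' * I)‖ * ‖Complex.cos (π * (x + y' * I) / 2)‖) ^ 2 ≤
        (4 * π ^ 2 * (1 + y') ^ (x - 1 / 2)) ^ 2 := by
      rw [mul_pow, mul_pow (4 * π ^ 2), hE]
      refine hmain.trans ?_
      have hπ3 : 0 < π ^ 3 := pow_pos Real.pi_pos 3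
      calc 4 * π ^ 3 * Real.exp ((2 * x - 1) * Real.log y')
          ≤ 4 * π ^ 3 * Real.exp ((2 * x - 1) * Real.log (1 + y')) := by gcongr
        _ ≤ (4 * π ^ 2) ^ 2 * Real.exp ((2 * x - 1) * Real.log (1 + y')) := by
          gcongr
          nlinarith
    have hB : 0 ≤ 4 * π ^ 2 * (1 + y') ^ (x - 1 / 2) := by positivity
    exact (abs_le_of_sq_le_sq' hsq hB).2
  · -- |y| < 1: crude bounds
    have hΓ : ‖Complex.Gamma (x + y' * I)‖ ≤ 2 := by
      refine (norm_Gamma_le_Gamma_re hx0 y').trans ?_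
      have h1 : Real.Gamma x ≤ max (Real.Gamma (1 / 2)) (Real.Gamma 1) :=
        Real.convexOn_Gamma.le_max_of_mem_Icc (by norm_num) (by norm_num) ⟨hx, hx1⟩
      refine h1.trans (max_le ?_ (by rw [Real.Gamma_one]; norm_num))
      rw [Real.Gamma_one_half_eq, Real.sqrt_le_left (by norm_num)]
      linarith [Real.pi_lt_four]
    have hcos : ‖Complex.cos (π * (x + y' * I) / 2)‖ ≤ Real.exp 2 := by
      refine (norm_cos_le_cosh_im _).trans ?_
      have him : (π * (x + y' * I) / 2 : ℂ).im = π * y' / 2 := by simp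
      rw [him, Real.cosh_eq]
      have h2 : Real.exp (π * y' / 2) ≤ Real.exp 2 :=
        Real.exp_le_exp.mpr (by nlinarith [Real.pi_lt_four])
      have h3 : Real.exp (-(π * y' / 2)) ≤ Real.exp 2 := Real.exp_le_exp.mpr (by nlinarith)
      linarith
    have he : Real.exp 2 ≤ 8 := by
      have := Real.exp_one_lt_d9
      rw [show (2 : ℝ) = 1 + 1 by norm_num, Real.exp_add]
      nlinarith [Real.exp_pos 1]
    calc ‖Complex.Gamma (x + y' * I)‖ * ‖Complex.cos (π * (x + y' * I) / 2)‖ ≤ 2 * 8 := by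
          gcongr
          exact hcos.trans he
      _ ≤ 4 * π ^ 2 * 1 := by nlinarith
      _ ≤ 4 * π ^ 2 * (1 + y') ^ (x - 1 / 2) := by gcongr

/-- **The functional-equation factor.** For `1/2 ≤ Re s ≤ 1`,
`‖2 (2π)^{-s} Γ(s) cos(πs/2)‖ ≤ 8π² (1 + |Im s|)^{Re s - 1/2}` (the factor of Mathlib's
`riemannZeta_one_sub : ζ(1-s) = 2(2π)^{-s}Γ(s)cos(πs/2)ζ(s)`; Titchmarsh (4.12.3) up to the constant).
[folklore] -/
theorem norm_fe_factor_le {s : ℂ} (hs : 1 / 2 ≤ s.re) (hs1 : s.re ≤ 1) :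
    ‖2 * (2 * (π : ℂ)) ^ (-s) * Complex.Gamma s * Complex.cos (π * s / 2)‖ ≤
      8 * π ^ 2 * (1 + |s.im|) ^ (s.re - 1 / 2) := by
  have hπ := Real.pi_gt_three
  have hs' : s = (s.re : ℂ) + (s.im : ℂ) * I := (Complex.re_add_im s).symm
  have hmain := norm_Gamma_mul_norm_cos_le hs hs1 s.im
  rw [← hs'] at hmain
  have hpow : ‖(2 * (π : ℂ)) ^ (-s)‖ ≤ 1 := by
    rw [show (2 * (π : ℂ)) = ((2 * π : ℝ) : ℂ) by push_cast; ring,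
      Complex.norm_cpow_eq_rpow_re_of_pos (by positivity)]
    refine Real.rpow_le_one_of_one_le_of_nonpos (by linarith) ?_
    simp; linarith
  have h0 : 0 ≤ (1 + |s.im|) ^ (s.re - 1 / 2) := by positivity
  calc ‖2 * (2 * (π : ℂ)) ^ (-s) * Complex.Gamma s * Complex.cos (π * s / 2)‖
      = 2 * ‖(2 * (π : ℂ)) ^ (-s)‖ * (‖Complex.Gamma s‖ * ‖Complex.cos (π * s / 2)‖) := by
        simp only [norm_mul, Complex.norm_ofNat]; ring
    _ ≤ 2 * 1 * (4 * π ^ 2 * (1 + |s.im|) ^ (s.re - 1 / 2)) := by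
        gcongr
    _ = 8 * π ^ 2 * (1 + |s.im|) ^ (s.re - 1 / 2) := by ring

end Literature.Analysis.SpecialFunctions.GammaVert

end
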